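import Mathlib
import HarnessLib
import Summits.NavierStokesRegularity.NavierStokesRegularity.Theses.HalfSpaceWindowDoor
import Summits.NavierStokesRegularity.NavierStokesRegularity.Theorems.HalfSpaceWindowDoorCirculationCarryingRigidityDefs
import Summits.NavierStokesRegularity.NavierStokesRegularity.Theorems.HalfSpaceWindowDoorCirculationCarryingRigidityReduction
import Summits.NavierStokesRegularity.NavierStokesRegularity.Theorems.HalfSpaceWindowDoorCirculationCarryingRigiditySubcriticalStretching
import Summits.NavierStokesRegularity.NavierStokesRegularity.Theorems.HalfSpaceWindowDoorCirculationCarryingRigidityExtremalProfile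

/-! # Line `extremal` (LEAD ns-hsw-p1 g2; RESHAPE PROPOSAL for the planner of record ns-idea-6, answering DIRECTOR-NS #170(3)
«re-type the stub so the structure is load-bearing») — crux `CirculationCarryingRigidity` (stmt-NavierStokesRegularity-25311).

NOT REGISTERED by this seat (the registered skeleton of record stays `Lines/birth` = `CirculationCarryingRigidity_birth_v2_g3.lean`,
sha b0f8cfc0, whose only open stub `stub_layerExclusion : StubLayerExclusion` is EQUIVALENT to the bare Liouville statement
`HemisphereLiouvilleE3`, tree `…Reduction.stubLayerExclusion_iff_hemisphereLiouvilleE3`).  This file re-types that one open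
stub through the tree theorem `…ExtremalProfile.hemisphereLiouvilleE3_iff_no_extremal` (p619808):

  `HemisphereLiouvilleE3 ⟺ NoExtremalHemisphereProfile`,

where an EXTREMAL closed-hemisphere profile is a closed-hemisphere profile `W` of the door class (rate `C`) that ATTAINS a
positive maximum `M` of the scale-invariant `e₃`-vorticity `(−s)·⟪curl W(s)(y), e₃⟫` at the normalized point `(−1, 0)`.
The new research stub `stub_noExtremalProfile` therefore carries LOAD-BEARING structure its prover may use
(`…ExtremalProfile.extremal_point_conditions`): at `(−1,0)` one has `∇ω₃ = 0`, `Δω₃ ≤ 0`, `∂ₛω₃ = M`, and the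
`e₃`-stretching `⟪DW[curl W], e₃⟫ = M − Δω₃ ≥ M = ω₃` (AT LEAST THE SIMILARITY RATE), while globally `0 ≤ (−s)ω₃ ≤ M`;
and every profile whose `e₃`-stretching stays below the similarity rate (`(−s)(ω·∇)v₃ ≤ θω₃`, `θ < 1`) is already
poloidal (`…SubcriticalStretching.inner_curl_e3_eq_zero_of_subcritical_stretching`, p619231).

`NoExtremalHemisphereProfile` is the tree definition `…Defs.NoExtremalHemisphereProfile` (p620979).
Stubs: `stub_noExtremalProfile` (RESEARCH, XL — the whole open content, = LRT arXiv:2501.08976 Rem 1.3 in extremal form).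
The landed stubs of `birth` (`stub_rotate` p611557, `stub_windowedFluxDecay` p611556) are consumed through
`…Reduction.circulationCarryingRigidity_of_hemisphereLiouvilleE3`.  `CirculationCarryingRigidity_of` concludes the route decl
BY NAME; sorries live ONLY in `stub_noExtremalProfile`.  No Navier–Stokes regularity statement is proved; door statements
concern HYPOTHETICAL blow-up profiles. -/

-- the summit and its single sub-problem share the name (CONVENTIONS §1)
set_option linter.dupNamespace false

namespace Summit.NavierStokesRegularity.NavierStokesRegularity.Cruxes.CirculationCarryingRigidity.Extremal

open scoped BigOperators Topology Classical MeasureTheory InnerProductSpace RealInnerProductSpace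
open Filter Set Function MeasureTheory
open Literature.Analysis Literature.Analysis.FluidPDE
open Summit.NavierStokesRegularity.NavierStokesRegularity.Theses.HalfSpaceWindowDoor
open Summit.NavierStokesRegularity.NavierStokesRegularity.Theorems.HalfSpaceWindowDoorCirculationCarryingRigidityDefs
open Summit.NavierStokesRegularity.NavierStokesRegularity.Theorems.HalfSpaceWindowDoorCirculationCarryingRigidityReduction
  (circulationCarryingRigidity_of_hemisphereLiouvilleE3)
open Summit.NavierStokesRegularity.NavierStokesRegularity.Theorems.HalfSpaceWindowDoorCirculationCarryingRigidityExtremalProfile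
  (hemisphereLiouvilleE3_iff_no_extremal)

/-- RESEARCH stub (XL — the research content of the crux in extremal form): there is no extremal closed-hemisphere
profile.  Its prover may use `…ExtremalProfile.extremal_point_conditions` (∇ω₃ = 0, Δω₃ ≤ 0, ∂ₛω₃ = M, stretching
`= M − Δω₃ ≥ M` at `(−1,0)`) and the subcritical exclusion `…SubcriticalStretching` (θ < 1 ⇒ poloidal). -/
theorem stub_noExtremalProfile : NoExtremalHemisphereProfile := by
  sorry

/-- Kernel-checked composition: the one open stub gives the crux BY NAME (via the tree theorems
`hemisphereLiouvilleE3_iff_no_extremal` (p619808) and `circulationCarryingRigidity_of_hemisphereLiouvilleE3` (p612323,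
itself `stub_rotate` p611557)). -/
theorem CirculationCarryingRigidity_of : CirculationCarryingRigidity :=
  circulationCarryingRigidity_of_hemisphereLiouvilleE3 (hemisphereLiouvilleE3_iff_no_extremal.2 stub_noExtremalProfile)

end Summit.NavierStokesRegularity.NavierStokesRegularity.Cruxes.CirculationCarryingRigidity.Extremal
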